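import Summits.AtomisticToContinuum.BoseEinsteinCondensation.Theses.BECInsertionCorrector
import Summits.AtomisticToContinuum.BoseEinsteinCondensation.Theorems.StaticResponseBound.Negative.Basic
import Literature.MathematicalPhysics.QuantumManyBody.BoseGasStructureFactor
import Literature.MathematicalPhysics.QuantumManyBody.PeriodicBoseGasMomentumSector
import Literature.MathematicalPhysics.QuantumManyBody.GroundStateDirichletForm
import HarnessLib

/-!
# Sector Cauchy–Schwarz for the static response bound — stub C2β

Helper file for the crux `BECInsertionCorrector.StaticResponseBound` (item
stmt-AtomisticToContinuum-12057), line `stable-fraction-square-completion`: the registered stub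
**C2β** `stub_sectorCauchySchwarz` (statement verbatim from the checked skeleton
`Cruxes/StaticResponseBound/Lines/stable-fraction-square-completion.lean`): the sector
decomposition (conclusion of stub C2α, taken as a hypothesis) implies the bilinear sector bound
`⟨∑ⱼcos(p·xⱼ)⟩_Ψ² ≤ 4((1 + D/Δ)/λ)(E_Ψ − E₀)` from an energy-controlled structure factor `(λ, D)`
and a floor `Δ` on the stiffer member of every sector pair `(q, q + k)`.
Proof: with `w_q = ‖Φc q‖²`, `X_q = ⟨Φc q, HΦc q⟩ − E₀w_q ≥ 0` (`∑w_q = 1`, `∑X_q = E_Ψ − E₀`),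
normalising a non-zero component (`PeriodicTrialState.ofFun`, homogeneity of the form) gives
`E₀w_q ≤ ⟨Φc q,HΦc q⟩`, the floor `Δw_s ≤ X_s` and `λ∫|ρ̂_k|²|Φc s|² ≤ (1 + D/Δ)X_s` on the
stiffer member `s`; Cauchy–Schwarz on the cell and then over `q` (both in the discriminant form
`2ab ≤ sa² + b²/s`, `discrim_le_zero` — no `Lᵖ` machinery) gives `|∑_q⟨Φc(q+k), ρ̂_kΦc q⟩|² ≤
4K(E − E₀)`, and `⟨∑cos⟩_Ψ = Re ∫ρ̂_k|Ψ|²`.  No new definitions.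
-/

namespace Summit.AtomisticToContinuum.BoseEinsteinCondensation.Cruxes.StaticResponseBound.StableFractionSquareCompletion

open MeasureTheory Filter
open scoped ENNReal ComplexConjugate
open Literature.MathematicalPhysics.QuantumManyBody.BoseGas
open Summit.AtomisticToContinuum.BoseEinsteinCondensation.Theses
open Summit.AtomisticToContinuum.BoseEinsteinCondensation.Theorems.StaticResponseBound.Negative

noncomputable section

variable {N : ℕ} {L : ℝ}

/-! ### Elementary Cauchy–Schwarz inequalities in discriminant form -/

/-- If `2 s x ≤ s² P + Q` for all `s > 0`, with `x, P, Q ≥ 0`, then `x² ≤ P Q`. [folklore] -/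
theorem scs_sq_le_mul_of_forall {x P Q : ℝ} (hx : 0 ≤ x) (hP : 0 ≤ P) (hQ : 0 ≤ Q)
    (h : ∀ s : ℝ, 0 < s → 2 * s * x ≤ s ^ 2 * P + Q) : x ^ 2 ≤ P * Q := by
  have key : ∀ s : ℝ, 0 ≤ P * (s * s) + -(2 * x) * s + Q := by
    intro s
    rcases le_or_gt s 0 with hs | hs
    · have h1 : 0 ≤ P * (s * s) := mul_nonneg hP (mul_self_nonneg s)
      nlinarith
    · have h1 := h s hs
      nlinarith
  have hd := discrim_le_zero key
  rw [discrim] at hd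
  nlinarith

/-- Cauchy–Schwarz on the fundamental cell for continuous integrands:
`‖∫ f g‖² ≤ (∫ ‖f‖²)(∫ ‖g‖²)`. [folklore] -/
theorem scs_norm_integral_mul_sq_le (L : ℝ) (f g : Config N → ℂ) (hf : Continuous f)
    (hg : Continuous g) :
    ‖∫ X in cellN N L, f X * g X‖ ^ 2 ≤
      (∫ X in cellN N L, ‖f X‖ ^ 2) * ∫ X in cellN N L, ‖g X‖ ^ 2 := by
  have hPi : Integrable (fun X => ‖f X‖ ^ 2) (volume.restrict (cellN N L)) :=
    integrableOn_cellN (hf.norm.pow 2) L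
  have hQi : Integrable (fun X => ‖g X‖ ^ 2) (volume.restrict (cellN N L)) :=
    integrableOn_cellN (hg.norm.pow 2) L
  have hyi : Integrable (fun X => ‖f X‖ * ‖g X‖) (volume.restrict (cellN N L)) :=
    integrableOn_cellN (hf.norm.mul hg.norm) L
  have hy0 : 0 ≤ ∫ X in cellN N L, ‖f X‖ * ‖g X‖ :=
    integral_nonneg fun X => mul_nonneg (norm_nonneg _) (norm_nonneg _)
  have hxy : ‖∫ X in cellN N L, f X * g X‖ ≤ ∫ X in cellN N L, ‖f X‖ * ‖g X‖ := by
    refine (norm_integral_le_integral_norm _).trans_eq (integral_congr_ae ?_)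
    exact Eventually.of_forall fun X => norm_mul _ _
  have hy2 : (∫ X in cellN N L, ‖f X‖ * ‖g X‖) ^ 2 ≤
      (∫ X in cellN N L, ‖f X‖ ^ 2) * ∫ X in cellN N L, ‖g X‖ ^ 2 := by
    refine scs_sq_le_mul_of_forall hy0 (integral_nonneg fun X => sq_nonneg _)
      (integral_nonneg fun X => sq_nonneg _) fun s hs => ?_
    calc 2 * s * ∫ X in cellN N L, ‖f X‖ * ‖g X‖
        = ∫ X in cellN N L, 2 * s * (‖f X‖ * ‖g X‖) := (integral_const_mul _ _).symm
      _ ≤ ∫ X in cellN N L, (s ^ 2 * ‖f X‖ ^ 2 + ‖g X‖ ^ 2) :=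
          integral_mono (hyi.const_mul _) ((hPi.const_mul _).add hQi) fun X => by
            have := sq_nonneg (s * ‖f X‖ - ‖g X‖)
            dsimp only
            nlinarith
      _ = s ^ 2 * (∫ X in cellN N L, ‖f X‖ ^ 2) + ∫ X in cellN N L, ‖g X‖ ^ 2 := by
          rw [integral_add (hPi.const_mul _) hQi, integral_const_mul]
  exact (pow_le_pow_left₀ (norm_nonneg _) hxy 2).trans hy2

/-- Cauchy–Schwarz over the pairs: if `‖T i‖² ≤ K aᵢ bᵢ` with `aᵢ, bᵢ ≥ 0` summing to `A, B` and
`∑ T i = S`, then `‖S‖² ≤ K A B`. [folklore] -/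
theorem scs_hasSum_norm_sq_le {ι : Type*} {T : ι → ℂ} {S : ℂ} {a b : ι → ℝ} {A B K : ℝ}
    (hT : HasSum T S) (ha : HasSum a A) (hb : HasSum b B) (ha0 : ∀ i, 0 ≤ a i)
    (hb0 : ∀ i, 0 ≤ b i) (hK : 0 ≤ K) (h : ∀ i, ‖T i‖ ^ 2 ≤ K * a i * b i) :
    ‖S‖ ^ 2 ≤ K * A * B := by
  refine scs_sq_le_mul_of_forall (norm_nonneg _) (mul_nonneg hK (ha.nonneg ha0)) (hb.nonneg hb0)
    fun s hs => ?_
  have h2s : (0 : ℝ) < 2 * s := by positivity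
  have hterm : ∀ i, ‖T i‖ ≤ (s ^ 2 * K * a i + b i) / (2 * s) := by
    intro i
    rw [le_div_iff₀ h2s]
    have h0 : 0 ≤ s ^ 2 * K * a i + b i := add_nonneg (mul_nonneg (by positivity) (ha0 i)) (hb0 i)
    have h1 : (‖T i‖ * (2 * s)) ^ 2 ≤ (s ^ 2 * K * a i + b i) ^ 2 := by
      have h2 : s ^ 2 * ‖T i‖ ^ 2 ≤ s ^ 2 * (K * a i * b i) :=
        mul_le_mul_of_nonneg_left (h i) (sq_nonneg s)
      nlinarith [sq_nonneg (s ^ 2 * K * a i - b i)]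
    exact (pow_le_pow_iff_left₀ (by positivity) h0 two_ne_zero).1 h1
  have hg : HasSum (fun i => (s ^ 2 * K * a i + b i) / (2 * s))
      ((s ^ 2 * K * A + B) / (2 * s)) :=
    ((ha.mul_left (s ^ 2 * K)).add hb).div_const (2 * s)
  have := hT.norm_le_of_bounded hg hterm
  rw [le_div_iff₀ h2s] at this
  linarith

/-- `⟨∑ⱼ cos(p·xⱼ)⟩_Ψ = Re ∫_{cell^N} ρ̂_k |Ψ|²`. [folklore] -/
theorem scs_cosMean_eq_re (L : ℝ) (k : Fin 3 → ℤ) (Ψ : PeriodicTrialState N L) :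
    cosMean L k Ψ =
      (∫ X in cellN N L, densityWave N L k X * (((‖Ψ.ψ X‖ ^ 2 : ℝ)) : ℂ)).re := by
  have hint : Integrable (fun X => densityWave N L k X * (((‖Ψ.ψ X‖ ^ 2 : ℝ)) : ℂ))
      (volume.restrict (cellN N L)) :=
    integrableOn_cellN ((continuous_densityWave L k).mul
      (Complex.continuous_ofReal.comp (Ψ.contDiff.continuous.norm.pow 2))) L
  have h1 := integral_re hint
  simp only [RCLike.re_to_complex] at h1
  rw [← h1]
  unfold cosMean
  refine integral_congr_ae (Eventually.of_forall fun X => ?_)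
  dsimp only
  rw [Complex.mul_re, Complex.ofReal_re, Complex.ofReal_im, mul_zero, sub_zero,
    densityWave_eq_sum, Complex.re_sum]
  refine congrArg (· * ‖Ψ.ψ X‖ ^ 2) (Finset.sum_congr rfl fun j _ => ?_)
  rw [Complex.exp_re]
  simp

/-- `(∫⁻_{cell^N} ‖θ‖₊²).toReal = ∫_{cell^N} ‖θ‖²` for continuous `θ`. [folklore] -/
theorem scs_toReal_lintegral_nnnorm_sq (L : ℝ) {θ : Config N → ℂ} (hθ : Continuous θ) :
    (∫⁻ X in cellN N L, (‖θ X‖₊ : ℝ≥0∞) ^ 2).toReal = ∫ X in cellN N L, ‖θ X‖ ^ 2 := by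
  rw [integral_eq_lintegral_of_nonneg_ae (Eventually.of_forall fun X => sq_nonneg _)
    (hθ.norm.pow 2).aestronglyMeasurable]
  simp_rw [coe_nnnorm_sq_eq_ofReal]

/-- **The two Cauchy–Schwarz splittings of a sector pairing** `∫ conj(θ₁) ρ̂_k θ₂`:
`|·|² ≤ ‖θ₁‖² ∫|ρ̂_k|²|θ₂|²` and `|·|² ≤ (∫|ρ̂_k|²|θ₁|²) ‖θ₂‖²`. [folklore] -/
theorem scs_pair_bound (L : ℝ) (k : Fin 3 → ℤ) {θ₁ θ₂ : Config N → ℂ} (h₁ : Continuous θ₁)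
    (h₂ : Continuous θ₂) :
    ‖∫ X in cellN N L, conj (θ₁ X) * (densityWave N L k X * θ₂ X)‖ ^ 2 ≤
        (∫ X in cellN N L, ‖θ₁ X‖ ^ 2) *
          ∫ X in cellN N L, ‖densityWave N L k X‖ ^ 2 * ‖θ₂ X‖ ^ 2 ∧
      ‖∫ X in cellN N L, conj (θ₁ X) * (densityWave N L k X * θ₂ X)‖ ^ 2 ≤
        (∫ X in cellN N L, ‖densityWave N L k X‖ ^ 2 * ‖θ₁ X‖ ^ 2) *
          ∫ X in cellN N L, ‖θ₂ X‖ ^ 2 := by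
  have hρ := continuous_densityWave (N := N) L k
  constructor
  · calc ‖∫ X in cellN N L, conj (θ₁ X) * (densityWave N L k X * θ₂ X)‖ ^ 2
        ≤ (∫ X in cellN N L, ‖conj (θ₁ X)‖ ^ 2) *
            ∫ X in cellN N L, ‖densityWave N L k X * θ₂ X‖ ^ 2 :=
          scs_norm_integral_mul_sq_le L (fun X => conj (θ₁ X))
            (fun X => densityWave N L k X * θ₂ X) (Complex.continuous_conj.comp h₁) (hρ.mul h₂)
      _ = _ := by
          congr 1
          · exact integral_congr_ae (Eventually.of_forall fun X => by
              dsimp only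
              rw [RCLike.norm_conj])
          · exact integral_congr_ae (Eventually.of_forall fun X => by
              dsimp only
              rw [norm_mul, mul_pow])
  · have hassoc : (∫ X in cellN N L, conj (θ₁ X) * (densityWave N L k X * θ₂ X)) =
        ∫ X in cellN N L, (conj (θ₁ X) * densityWave N L k X) * θ₂ X :=
      integral_congr_ae (Eventually.of_forall fun X => (mul_assoc _ _ _).symm)
    rw [hassoc]
    calc ‖∫ X in cellN N L, (conj (θ₁ X) * densityWave N L k X) * θ₂ X‖ ^ 2
        ≤ (∫ X in cellN N L, ‖conj (θ₁ X) * densityWave N L k X‖ ^ 2) *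
            ∫ X in cellN N L, ‖θ₂ X‖ ^ 2 :=
          scs_norm_integral_mul_sq_le L (fun X => conj (θ₁ X) * densityWave N L k X) θ₂
            ((Complex.continuous_conj.comp h₁).mul hρ) h₂
      _ = _ := by
          congr 1
          exact integral_congr_ae (Eventually.of_forall fun X => by
            dsimp only
            rw [norm_mul, RCLike.norm_conj, mul_pow, mul_comm])

/-- **Component bounds.** For a `C¹` periodic symmetric `θ` of total momentum `p` with
`w = ∫‖θ‖² < ∞` and finite energy form `Ẽ = ⟨θ, Hθ⟩`: `E₀ w ≤ Ẽ`; a floor `E₀ + Δ` on the sector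
`p` gives `(E₀ + Δ) w ≤ Ẽ`; an energy-controlled structure factor `(λ, D)` gives
`λ ∫|ρ̂_k|²|θ|² ≤ Ẽ − E₀ w + D w` (normalise `θ` by `PeriodicTrialState.ofFun` if `w ≠ 0` and use
the homogeneity of the form; trivial if `w = 0`). [folklore] -/
theorem scs_component_bounds (v : ℝ → ℝ≥0∞) (k : Fin 3 → ℤ) {lam D Δ : ℝ} (hΔ : 0 ≤ Δ)
    (p : Space) {θ : Config N → ℂ} (hC : ContDiff ℝ 1 θ)
    (hper : ∀ (X : Config N) (i : Fin N) (a : Fin 3),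
      θ (X + Pi.single i (EuclideanSpace.single a L)) = θ X)
    (hsymm : ∀ (σ : Equiv.Perm (Fin N)) (X : Config N), θ (X ∘ σ) = θ X)
    (hmom : HasTotalMomentum p θ) (hwtop : ∫⁻ X in cellN N L, ((‖θ X‖₊ : ℝ≥0∞)) ^ 2 ≠ ⊤)
    {Ek : ℝ≥0∞} (hEk : ∫⁻ X in cellN N L,
      (kineticDensity θ X + periodicInteraction v L X * (‖θ X‖₊ : ℝ≥0∞) ^ 2) = Ek)
    (hEktop : Ek ≠ ⊤)
    (hECSF : ∀ Φ : PeriodicTrialState N L, periodicEnergy v Φ ≠ ⊤ →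
      lam * ∫ X in cellN N L, ‖densityWave N L k X‖ ^ 2 * ‖Φ.ψ X‖ ^ 2 ≤
        (periodicEnergy v Φ).toReal - (periodicGroundStateEnergy v N L).toReal + D) :
    (periodicGroundStateEnergy v N L).toReal * (∫ X in cellN N L, ‖θ X‖ ^ 2) ≤ Ek.toReal ∧
      (periodicGroundStateEnergy v N L + ENNReal.ofReal Δ ≤ momentumSectorEnergy v N L p →
        ((periodicGroundStateEnergy v N L).toReal + Δ) * (∫ X in cellN N L, ‖θ X‖ ^ 2) ≤
          Ek.toReal) ∧
      lam * (∫ X in cellN N L, ‖densityWave N L k X‖ ^ 2 * ‖θ X‖ ^ 2) ≤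
        Ek.toReal - (periodicGroundStateEnergy v N L).toReal * (∫ X in cellN N L, ‖θ X‖ ^ 2) +
          D * ∫ X in cellN N L, ‖θ X‖ ^ 2 := by
  set E₀ := periodicGroundStateEnergy v N L with hE₀
  have hcont : Continuous θ := hC.continuous
  rw [← scs_toReal_lintegral_nnnorm_sq L hcont]
  set w := ∫⁻ X in cellN N L, ((‖θ X‖₊ : ℝ≥0∞)) ^ 2 with hw
  have hEs0 : 0 ≤ Ek.toReal := ENNReal.toReal_nonneg
  rcases eq_or_ne w 0 with hw0 | hw0
  · -- degenerate component: every term vanishes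
    have hae : (fun X => ((‖θ X‖₊ : ℝ≥0∞)) ^ 2) =ᵐ[volume.restrict (cellN N L)] 0 :=
      (lintegral_eq_zero_iff'
        (hcont.measurable.nnnorm.coe_nnreal_ennreal.pow_const 2).aemeasurable).1 hw0
    have hR : (∫ X in cellN N L, ‖densityWave N L k X‖ ^ 2 * ‖θ X‖ ^ 2) = 0 := by
      refine integral_eq_zero_of_ae (hae.mono fun X hX => ?_)
      have hX' : θ X = 0 := by simpa using hX
      simp [hX']
    rw [hw0, ENNReal.toReal_zero, hR]
    simp only [mul_zero, sub_zero, add_zero]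
    exact ⟨hEs0, fun _ => hEs0, hEs0⟩
  · -- normalise: `φ = θ/‖θ‖`, `E_φ = w⁻¹ Ẽ`, `∫|ρ̂_k|²|φ|² = w⁻¹ ∫|ρ̂_k|²|θ|²`
    set φ := PeriodicTrialState.ofFun θ hC hper hsymm hw0 hwtop with hφ
    have hwpos : 0 < w.toReal := ENNReal.toReal_pos hw0 hwtop
    have hw' : w.toReal ≠ 0 := hwpos.ne'
    have hc : ‖((Real.sqrt w.toReal)⁻¹ : ℂ)‖ ^ 2 = w.toReal⁻¹ := by
      rw [norm_inv, Complex.norm_real, Real.norm_of_nonneg (Real.sqrt_nonneg _), inv_pow,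
        Real.sq_sqrt hwpos.le]
    have hc2 : ((‖((Real.sqrt w.toReal)⁻¹ : ℂ)‖₊ : ℝ≥0∞)) ^ 2 = w⁻¹ := by
      rw [coe_nnnorm_sq_eq_ofReal, hc, ENNReal.ofReal_inv_of_pos hwpos,
        ENNReal.ofReal_toReal hwtop]
    have hψ : φ.ψ = fun Y => ((Real.sqrt w.toReal)⁻¹ : ℂ) * θ Y := rfl
    have hEφ : periodicEnergy v φ = w⁻¹ * Ek := by
      rw [← hEk, periodicEnergy, ← lintegral_const_mul' _ _ (ENNReal.inv_ne_top.2 hw0), hψ]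
      refine lintegral_congr fun X => ?_
      rw [kineticDensity_const_mul_complex _ θ X, nnnorm_mul, ENNReal.coe_mul, mul_pow, hc2]
      ring
    have hRφ : (∫ X in cellN N L, ‖densityWave N L k X‖ ^ 2 * ‖φ.ψ X‖ ^ 2) =
        w.toReal⁻¹ * ∫ X in cellN N L, ‖densityWave N L k X‖ ^ 2 * ‖θ X‖ ^ 2 := by
      rw [← integral_const_mul, hψ]
      refine integral_congr_ae (Eventually.of_forall fun X => ?_)
      dsimp only
      rw [norm_mul, mul_pow, hc]
      ring
    have hEφtop : periodicEnergy v φ ≠ ⊤ := by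
      rw [hEφ]
      exact ENNReal.mul_ne_top (ENNReal.inv_ne_top.2 hw0) hEktop
    have hEφr : (periodicEnergy v φ).toReal = Ek.toReal / w.toReal := by
      rw [hEφ, ENNReal.toReal_mul, ENNReal.toReal_inv, inv_mul_eq_div]
    have hE0top : E₀ ≠ ⊤ := ne_top_of_le_ne_top hEφtop (periodicGroundStateEnergy_le v φ)
    refine ⟨?_, fun hfl => ?_, ?_⟩
    · have h := ENNReal.toReal_mono hEφtop (periodicGroundStateEnergy_le v φ)
      rwa [hEφr, le_div_iff₀ hwpos] at h
    · have h := ENNReal.toReal_mono hEφtop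
        (hfl.trans (momentumSectorEnergy_le v φ (hmom.ofFun hC hper hsymm hw0 hwtop)))
      rwa [ENNReal.toReal_add hE0top ENNReal.ofReal_ne_top, ENNReal.toReal_ofReal hΔ, hEφr,
        le_div_iff₀ hwpos] at h
    · have h := mul_le_mul_of_nonneg_right (hECSF φ hEφtop) hwpos.le
      rw [hRφ, hEφr, add_mul, sub_mul, div_mul_cancel₀ _ hw', mul_comm (w.toReal)⁻¹,
        mul_assoc, mul_assoc, inv_mul_cancel₀ hw', mul_one] at h
      exact h

/-- **Assembly over the sectors.** Weights `ws ≥ 0` summing to `1`, energies `Es` summing to `E`,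
`E₀ ws ≤ Es`, the scaled structure-factor bound, and on the stiffer member of each pair `(q, q + k)`
the floor with the matching splitting of `T q` give `|∑ T q|² ≤ 4((1 + D/Δ)/λ)(E − E₀)`.
[folklore] -/
theorem scs_real_assembly {k : Fin 3 → ℤ} {T : (Fin 3 → ℤ) → ℂ} {S : ℂ}
    {ws Es R : (Fin 3 → ℤ) → ℝ} {E₀r Er lam D Δ : ℝ} (hlam : 0 < lam) (hD : 0 ≤ D)
    (hΔ : 0 < Δ) (hT : HasSum T S) (hws : HasSum ws 1) (hEs : HasSum Es Er)
    (hws0 : ∀ q, 0 ≤ ws q) (h1 : ∀ q, E₀r * ws q ≤ Es q)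
    (h3 : ∀ q, lam * R q ≤ Es q - E₀r * ws q + D * ws q)
    (h2 : ∀ q, ((E₀r + Δ) * ws q ≤ Es q ∧ ‖T q‖ ^ 2 ≤ ws (q + k) * R q) ∨
      ((E₀r + Δ) * ws (q + k) ≤ Es (q + k) ∧ ‖T q‖ ^ 2 ≤ R (q + k) * ws q)) :
    ‖S‖ ^ 2 ≤ 4 * ((1 + D / Δ) / lam) * (Er - E₀r) := by
  set K := (1 + D / Δ) / lam with hK
  have hK0 : 0 ≤ K := by positivity
  set Xs : (Fin 3 → ℤ) → ℝ := fun q => Es q - E₀r * ws q with hXs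
  have hX0 : ∀ q, 0 ≤ Xs q := fun q => by
    simp only [hXs]
    linarith [h1 q]
  -- the floor and the structure-factor bound on the stiffer member: `R ≤ K X`
  have hRK : ∀ q, (E₀r + Δ) * ws q ≤ Es q → R q ≤ K * Xs q := by
    intro q hq
    have hDws : D * ws q ≤ D / Δ * Xs q := by
      rw [div_mul_eq_mul_div, le_div_iff₀ hΔ]
      have hws_le : Δ * ws q ≤ Xs q := by
        simp only [hXs]
        linarith
      nlinarith
    have h4 : lam * R q ≤ (1 + D / Δ) * Xs q := by
      have := h3 q
      simp only [hXs] at *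
      linarith
    rw [hK, div_mul_eq_mul_div, le_div_iff₀ hlam]
    linarith
  -- the pair bound
  have hpair : ∀ q, ‖T q‖ ^ 2 ≤ K * (ws q + ws (q + k)) * (Xs q + Xs (q + k)) := by
    intro q
    have t1 := mul_nonneg (mul_nonneg hK0 (hws0 q)) (hX0 q)
    have t2 := mul_nonneg (mul_nonneg hK0 (hws0 q)) (hX0 (q + k))
    have t3 := mul_nonneg (mul_nonneg hK0 (hws0 (q + k))) (hX0 q)
    have t4 := mul_nonneg (mul_nonneg hK0 (hws0 (q + k))) (hX0 (q + k))
    rcases h2 q with ⟨hf, hcs⟩ | ⟨hf, hcs⟩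
    · have h' := mul_le_mul_of_nonneg_left (hRK q hf) (hws0 (q + k))
      linarith
    · have h' := mul_le_mul_of_nonneg_right (hRK (q + k) hf) (hws0 q)
      linarith
  -- the sums (reindex `q ↦ q + k` by `Equiv.addRight k`)
  have ha : HasSum (fun q => ws q + ws (q + k)) (1 + 1) :=
    hws.add ((Equiv.addRight k).hasSum_iff.2 hws)
  have hXsum : HasSum Xs (Er - E₀r * 1) := hEs.sub (hws.mul_left E₀r)
  have hb : HasSum (fun q => Xs q + Xs (q + k)) ((Er - E₀r * 1) + (Er - E₀r * 1)) :=
    hXsum.add ((Equiv.addRight k).hasSum_iff.2 hXsum)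
  have key := scs_hasSum_norm_sq_le hT ha hb (fun q => add_nonneg (hws0 _) (hws0 _))
    (fun q => add_nonneg (hX0 _) (hX0 _)) hK0 hpair
  calc ‖S‖ ^ 2 ≤ K * (1 + 1) * ((Er - E₀r * 1) + (Er - E₀r * 1)) := key
    _ = 4 * ((1 + D / Δ) / lam) * (Er - E₀r) := by
        rw [hK]
        ring

/-! ### The registered stub -/

/-- **C2β `stub_sectorCauchySchwarz`** (statement verbatim from the checked skeleton of the line
`stable-fraction-square-completion`): the sector decomposition (conclusion of stub C2α, taken as a
HYPOTHESIS) implies the sector Cauchy–Schwarz bound: at fixed `(N, L > 0, k ≠ 0)`, an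
energy-controlled structure factor `λ ∫|ρ̂_k|²|Φ|² ≤ E_Φ − E₀ + D` for every finite-energy `Φ` and a
floor `E₀ + Δ` on the stiffer member of every sector pair `(q, q + k)` give
`⟨∑ⱼcos(p·xⱼ)⟩_Ψ² ≤ 4((1 + D/Δ)/λ)(E_Ψ − E₀)` for every finite-energy `Ψ`. [folklore] -/
theorem stub_sectorCauchySchwarz :
    (∀ (v : ℝ → ℝ≥0∞) (N : ℕ) (L : ℝ), 0 < L → ∀ (k : Fin 3 → ℤ) (Ψ : PeriodicTrialState N L),
      ∃ Φc : (Fin 3 → ℤ) → Config N → ℂ,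
        (∀ q, ContDiff ℝ 1 (Φc q)) ∧
        (∀ q (X : Config N) (i : Fin N) (a : Fin 3),
          Φc q (X + Pi.single i (EuclideanSpace.single a L)) = Φc q X) ∧
        (∀ q (σ : Equiv.Perm (Fin N)) (X : Config N), Φc q (X ∘ σ) = Φc q X) ∧
        (∀ q, HasTotalMomentum
          ((2 * Real.pi / L) • (WithLp.toLp 2 fun t => (q t : ℝ) : EuclideanSpace ℝ (Fin 3))) (Φc q)) ∧
        (∑' q, ∫⁻ X in cellN N L, (‖Φc q X‖₊ : ℝ≥0∞) ^ 2) = 1 ∧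
        (∑' q, ∫⁻ X in cellN N L,
            (kineticDensity (Φc q) X + periodicInteraction v L X * (‖Φc q X‖₊ : ℝ≥0∞) ^ 2)) =
          periodicEnergy v Ψ ∧
        HasSum (fun q : Fin 3 → ℤ =>
            ∫ X in cellN N L, conj (Φc (q + k) X) * (densityWave N L k X * Φc q X))
          (∫ X in cellN N L, densityWave N L k X * (((‖Ψ.ψ X‖ ^ 2 : ℝ)) : ℂ))) →
    ∀ (v : ℝ → ℝ≥0∞) (N : ℕ) (L : ℝ), 0 < L → ∀ (k : Fin 3 → ℤ), k ≠ 0 →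
      ∀ (lam D Δ : ℝ), 0 < lam → 0 ≤ D → 0 < Δ →
      (∀ Φ : PeriodicTrialState N L, periodicEnergy v Φ ≠ ⊤ →
        lam * ∫ X in cellN N L, ‖densityWave N L k X‖ ^ 2 * ‖Φ.ψ X‖ ^ 2 ≤
          (periodicEnergy v Φ).toReal - (periodicGroundStateEnergy v N L).toReal + D) →
      (∀ q : Fin 3 → ℤ,
        periodicGroundStateEnergy v N L + ENNReal.ofReal Δ ≤
            momentumSectorEnergy v N L
              ((2 * Real.pi / L) • (WithLp.toLp 2 fun t => (q t : ℝ) : EuclideanSpace ℝ (Fin 3))) ∨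
        periodicGroundStateEnergy v N L + ENNReal.ofReal Δ ≤
            momentumSectorEnergy v N L
              ((2 * Real.pi / L) •
                (WithLp.toLp 2 fun t => ((q + k) t : ℝ) : EuclideanSpace ℝ (Fin 3)))) →
      ∀ Ψ : PeriodicTrialState N L, periodicEnergy v Ψ ≠ ⊤ →
        cosMean L k Ψ ^ 2 ≤
          4 * ((1 + D / Δ) / lam) *
            ((periodicEnergy v Ψ).toReal - (periodicGroundStateEnergy v N L).toReal) := by
  intro hDec v N L hL k _hk lam D Δ hlam hD hΔ hECSF hFloor Ψ hΨ
  obtain ⟨Φc, hC1, hper, hsymm, hmom, hnorm, henergy, hpair⟩ := hDec v N L hL k Ψ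
  have hcont : ∀ q, Continuous (Φc q) := fun q => (hC1 q).continuous
  -- finiteness of the weights and of the energies of the components
  have hsum1 : (∑' q, ∫⁻ X in cellN N L, (‖Φc q X‖₊ : ℝ≥0∞) ^ 2) ≠ ⊤ :=
    ne_of_eq_of_ne hnorm ENNReal.one_ne_top
  have hsum2 : (∑' q, ∫⁻ X in cellN N L,
      (kineticDensity (Φc q) X + periodicInteraction v L X * (‖Φc q X‖₊ : ℝ≥0∞) ^ 2)) ≠ ⊤ :=
    ne_of_eq_of_ne henergy hΨ
  have hw_ne := ENNReal.ne_top_of_tsum_ne_top hsum1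
  have hEk_ne := ENNReal.ne_top_of_tsum_ne_top hsum2
  -- the real weights and energies and their sums
  have hws : HasSum (fun q => ∫ X in cellN N L, ‖Φc q X‖ ^ 2) 1 := by
    have h := ENNReal.hasSum_toReal hsum1
    rw [← ENNReal.tsum_toReal_eq hw_ne, hnorm, ENNReal.toReal_one] at h
    exact h.congr_fun fun q => (scs_toReal_lintegral_nnnorm_sq L (hcont q)).symm
  have hEs : HasSum (fun q => (∫⁻ X in cellN N L, (kineticDensity (Φc q) X +
      periodicInteraction v L X * (‖Φc q X‖₊ : ℝ≥0∞) ^ 2)).toReal)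
      (periodicEnergy v Ψ).toReal := by
    have h := ENNReal.hasSum_toReal hsum2
    rwa [← ENNReal.tsum_toReal_eq hEk_ne, henergy] at h
  -- the component bounds and the real bookkeeping
  have hcomp := fun q => scs_component_bounds v k hΔ.le _ (hC1 q) (hper q) (hsymm q) (hmom q)
    (hw_ne q) rfl (hEk_ne q) hECSF
  have key := scs_real_assembly (k := k)
    (R := fun q => ∫ X in cellN N L, ‖densityWave N L k X‖ ^ 2 * ‖Φc q X‖ ^ 2)
    (E₀r := (periodicGroundStateEnergy v N L).toReal) hlam hD hΔ hpair hws hEs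
    (fun q => integral_nonneg fun X => sq_nonneg _) (fun q => (hcomp q).1)
    (fun q => (hcomp q).2.2) fun q => by
      rcases hFloor q with hf | hf
      · exact Or.inl ⟨(hcomp q).2.1 hf, (scs_pair_bound L k (hcont (q + k)) (hcont q)).1⟩
      · exact Or.inr ⟨(hcomp (q + k)).2.1 hf, (scs_pair_bound L k (hcont (q + k)) (hcont q)).2⟩
  rw [scs_cosMean_eq_re L k Ψ]
  refine le_trans ?_ key
  have hre := abs_le.1 (Complex.abs_re_le_norm
    (∫ X in cellN N L, densityWave N L k X * (((‖Ψ.ψ X‖ ^ 2 : ℝ)) : ℂ)))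
  exact sq_le_sq' hre.1 hre.2

end

end Summit.AtomisticToContinuum.BoseEinsteinCondensation.Cruxes.StaticResponseBound.StableFractionSquareCompletion
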